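import Summits.CriticalPhenomena.Ising3D.ExclusionSentencesKacx

/-!
# Exclusion sentences — the central-charge tables of families `KAC` and `KACX` (kind `c`)
(cell `pub-ising3x`, seat recog-1)

HONEST FRAMING: lottery ticket; floor = tightest certified 3D Ising CFT bounds; no exact-solution
claim without a proof.

FAMILIES-v1 (`HOME/frozen/FAMILIES-v1.json` b39f709f…, SCOPE.md §3.1) applies the rational-CFT families
`KAC` and `KACX` to TWO kinds of data: `Delta` (the weight tables, kernel form in
`ExclusionSentences.lean` / `ExclusionSentencesKacx.lean`) and `c` (the central charge of each table —
in the 2D control the Virasoro `c`, recognised blind as `1/2` at five certified digits in round R2; in 3D the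
exploratory secondary datum `c_T / c_T^free`). This file is the kernel form of the kind-`c` tables,
transcribed loop for loop from `HOME/code/recog/families.py` (`kac_virasoro` → `Cc`, `kacx_tables` → `Cc`):
* `virC p p′ = 1 − 6(p′−p)²/(pp′)` for coprime `2 ≤ p < p′ ≤ N` (Virasoro minimal models `M(p,p′)`,
  Belavin–Polyakov–Zamolodchikov 1984; Di Francesco–Mathieu–Sénéchal 1997 eq. (7.65)); `cKacFamily N`
  (156 values at `N = 24`), checker `cKacExcluded N a b ex` + `cKacExcluded_sound`;
* `n1C p p′ = 3/2 (1 − 2(p′−p)²/(pp′))` (`N = 1` models `SM(p,p′)`, admissibility `n1Admissible` as for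
  the weights), `w3C p p′ = 2 (1 − 12(p′−p)²/(pp′))` (`W₃(p,p′)`, `3 ≤ p < p′` coprime),
  `su2C k = 3k/(k+2)` (`SU(2)_k`, `1 ≤ k`, size `k+2 ≤ S`), `zkC k = 2(k−1)/(k+2)` (`ℤ_k`, `2 ≤ k`,
  `k+2 ≤ S`) (Di Francesco–Mathieu–Sénéchal 1997 ch. 18); `cKacxFamily = n1C(p′ ≤ 24) ∪ w3C(p′ ≤ 16) ∪
  su2C(k+2 ≤ 40) ∪ zkC(k+2 ≤ 40)` (196 values), checker `cKacxExcluded a b ex` + `cKacxExcluded_sound`;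
* real-number forms `ne_cKac_of_cKacExcluded`, `ne_cKacx_of_cKacxExcluded`.
All checkers are the integer pattern of `ExclusionSentencesKacx.lean` (`ratOutOrListed`: outside `[a, b]`
by cross-multiplication, or a listed exception); the loops run over the whole (small) tables, so every
sentence costs well under a second of kernel time. Validation (two implementations): on the window
`[0.45, 0.55]` the kernel accepts exactly the member lists of `families.py` — KAC `{1/2}`, KACX
`{10/21 (W₃(7,9)), 297/598 (SM(13,23)), 1/2 (ℤ₂), 15/28 (SM(8,14))}` — and rejects each list with one
member removed (`ExclusionSentencesControl2DC.lean` carries the control instances). The floor statement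
`IsingEnclosure W R` concerns `(Δσ, Δε)` only, so there is no bridge theorem here: these sentences serve
the 2D control's `c` verdicts and any future certified interval for a `c`-kind datum. No 3D digit is used.
-/

namespace Summit.CriticalPhenomena.Ising3D

/-! ### `KAC`, kind `c`: Virasoro minimal-model central charges -/

/-- Numerator of `c(M(p,p′))` over `p p′`: `p p′ − 6 (p′ − p)²`. -/
def virCNum (p pp : ℕ) : ℤ := ((p * pp : ℕ) : ℤ) - 6 * ((pp : ℤ) - (p : ℤ)) ^ 2

/-- `c(M(p,p′)) = 1 − 6(p′−p)²/(pp′)` as one fraction over `p p′`. -/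
def virC (p pp : ℕ) : ℚ := ((virCNum p pp : ℤ) : ℚ) / ((p * pp : ℕ) : ℚ)

/-- `virC` is the textbook formula `1 − 6 (p′ − p)² / (p p′)`. -/
theorem virC_eq {p pp : ℕ} (hp : 0 < p) (hpp : 0 < pp) :
    virC p pp = 1 - 6 * ((pp : ℚ) - p) ^ 2 / (p * pp) := by
  unfold virC virCNum
  have hp0 : (p : ℚ) ≠ 0 := by positivity
  have hpp0 : (pp : ℚ) ≠ 0 := by positivity
  push_cast
  field_simp

/-- `cKacFamily N` = FAMILIES-v1 `KAC`, kind `c`: all `c(M(p,p′))` with coprime `2 ≤ p < p′ ≤ N`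
(non-unitary models included, as in `families.py kac_virasoro`; 156 values at `N = 24`). -/
def cKacFamily (N : ℕ) : Set ℚ :=
  {c | ∃ p pp : ℕ, 2 ≤ p ∧ p < pp ∧ pp ≤ N ∧ Nat.Coprime p pp ∧ c = virC p pp}

/-- Sanity check of the conventions: the 2D Ising value `c = 1/2 = c(M(3,4))` is a member. -/
theorem half_mem_cKacFamily : (1 / 2 : ℚ) ∈ cKacFamily 24 :=
  ⟨3, 4, by norm_num, by norm_num, by norm_num, by norm_num, by norm_num [virC, virCNum]⟩

/-- Integer core of the KAC kind-`c` checker (pattern of `su2Core`). -/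
def cKacCore (N : ℕ) (an : ℤ) (ad : ℕ) (bn : ℤ) (bd : ℕ) (ex : List (ℤ × ℕ)) : Bool :=
  (List.range' 3 (N - 2)).all fun pp =>
    (List.range' 2 (pp - 2)).all fun p =>
      !(Nat.gcd p pp == 1) || ratOutOrListed (virCNum p pp) (p * pp) an ad bn bd ex

/-- `cKacExcluded N a b ex = true` certifies: every `c(M(p,p′))` (`p′ ≤ N`) in `[a, b]` is listed in `ex`. -/
def cKacExcluded (N : ℕ) (a b : ℚ) (ex : List ℚ) : Bool := cKacCore N a.num a.den b.num b.den (exZ ex)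

/-- **Soundness of the KAC kind-`c` sentence.** -/
theorem cKacExcluded_sound {N : ℕ} {a b : ℚ} {ex : List ℚ} (h : cKacExcluded N a b ex = true)
    {v : ℚ} (hv : v ∈ cKacFamily N) (ha : a ≤ v) (hb : v ≤ b) : v ∈ ex := by
  obtain ⟨p, pp, hp, hppp, hN, hcop, rfl⟩ := hv
  unfold cKacExcluded cKacCore at h
  have h1 := List.all_eq_true.mp h pp (List.mem_range'_1.mpr ⟨by omega, by omega⟩)
  have h2 := List.all_eq_true.mp h1 p (List.mem_range'_1.mpr ⟨hp, by omega⟩)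
  rw [Bool.or_eq_true] at h2
  rcases h2 with h2 | h2
  · simp [Nat.Coprime.gcd_eq_one hcop] at h2
  · exact ratOutOrListed_sound (Nat.mul_pos (by omega) (by omega)) h2 ha hb

/-- Real-number form of the KAC kind-`c` sentence. -/
theorem ne_cKac_of_cKacExcluded {N : ℕ} {a b : ℚ} {ex : List ℚ} (h : cKacExcluded N a b ex = true)
    {x : ℝ} (hx : (a : ℝ) ≤ x ∧ x ≤ b) (v : ℚ) (hv : v ∈ cKacFamily N) (hvex : v ∉ ex) :
    x ≠ (v : ℝ) := by
  rintro rfl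
  exact hvex (cKacExcluded_sound h hv (by exact_mod_cast hx.1) (by exact_mod_cast hx.2))

/-! ### `KACX`, kind `c`: the central charges of the four further tables -/

/-- Numerator of `c(SM(p,p′)) = 3/2 (1 − 2(p′−p)²/(pp′))` over `2 p p′`: `3 p p′ − 6 (p′ − p)²`. -/
def n1CNum (p pp : ℕ) : ℤ := 3 * ((p * pp : ℕ) : ℤ) - 6 * ((pp : ℤ) - (p : ℤ)) ^ 2

/-- `c(SM(p,p′))` as one fraction over `2 p p′`. -/
def n1C (p pp : ℕ) : ℚ := ((n1CNum p pp : ℤ) : ℚ) / ((2 * p * pp : ℕ) : ℚ)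

/-- `n1C` is the printed formula `3/2 · (1 − 2 (p′ − p)²/(p p′))` (Friedan–Qiu–Shenker 1985). -/
theorem n1C_eq {p pp : ℕ} (hp : 0 < p) (hpp : 0 < pp) :
    n1C p pp = 3 / 2 * (1 - 2 * ((pp : ℚ) - p) ^ 2 / (p * pp)) := by
  unfold n1C n1CNum
  have hp0 : (p : ℚ) ≠ 0 := by positivity
  have hpp0 : (pp : ℚ) ≠ 0 := by positivity
  push_cast
  field_simp
  ring

/-- Numerator of `c(W₃(p,p′)) = 2 (1 − 12(p′−p)²/(pp′))` over `p p′`: `2 p p′ − 24 (p′ − p)²`. -/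
def w3CNum (p pp : ℕ) : ℤ := 2 * ((p * pp : ℕ) : ℤ) - 24 * ((pp : ℤ) - (p : ℤ)) ^ 2

/-- `c(W₃(p,p′))` as one fraction over `p p′`. -/
def w3C (p pp : ℕ) : ℚ := ((w3CNum p pp : ℤ) : ℚ) / ((p * pp : ℕ) : ℚ)

/-- `w3C` is the printed formula `2 · (1 − 12 (p′ − p)²/(p p′))` (Fateev–Zamolodchikov 1987). -/
theorem w3C_eq {p pp : ℕ} (hp : 0 < p) (hpp : 0 < pp) :
    w3C p pp = 2 * (1 - 12 * ((pp : ℚ) - p) ^ 2 / (p * pp)) := by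
  unfold w3C w3CNum
  have hp0 : (p : ℚ) ≠ 0 := by positivity
  have hpp0 : (pp : ℚ) ≠ 0 := by positivity
  push_cast
  field_simp
  ring

/-- `c(SU(2)_k) = 3k/(k+2)` (Knizhnik–Zamolodchikov 1984). -/
def su2C (k : ℕ) : ℚ := (((3 * k : ℕ) : ℤ) : ℚ) / ((k + 2 : ℕ) : ℚ)

/-- `c(ℤ_k) = 2(k−1)/(k+2)` (Fateev–Zamolodchikov 1985), written for `1 ≤ k`. -/
def zkC (k : ℕ) : ℚ := (((2 * (k - 1) : ℕ) : ℤ) : ℚ) / ((k + 2 : ℕ) : ℚ)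

/-- `cKacxFamily` = FAMILIES-v1 `KACX`, kind `c`: the central charges of `SM(p,p′)` (`p′ ≤ 24`,
admissible), `W₃(p,p′)` (`3 ≤ p < p′ ≤ 16` coprime), `SU(2)_k` (`1 ≤ k`, `k + 2 ≤ 40`) and `ℤ_k`
(`2 ≤ k`, `k + 2 ≤ 40`) — exactly the `Cc` entries of `families.py kacx_tables` (196 values). -/
def cKacxFamily : Set ℚ :=
  {c | ∃ p pp : ℕ, 2 ≤ p ∧ p < pp ∧ pp ≤ 24 ∧ n1Admissible p pp = true ∧ c = n1C p pp} ∪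
  {c | ∃ p pp : ℕ, 3 ≤ p ∧ p < pp ∧ pp ≤ 16 ∧ Nat.Coprime p pp ∧ c = w3C p pp} ∪
  {c | ∃ k : ℕ, 1 ≤ k ∧ k + 2 ≤ 40 ∧ c = su2C k} ∪
  {c | ∃ k : ℕ, 2 ≤ k ∧ k + 2 ≤ 40 ∧ c = zkC k}

/-- Sanity check: `c(ℤ₂) = 1/2` (the Ising model as the `k = 2` parafermion) is a member. -/
theorem half_mem_cKacxFamily : (1 / 2 : ℚ) ∈ cKacxFamily :=
  Or.inr ⟨2, by norm_num, by norm_num, by norm_num [zkC]⟩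

/-- Integer core of the KACX kind-`c` checker: the four loops of `families.py kacx_tables` (`Cc` lines). -/
def cKacxCore (an : ℤ) (ad : ℕ) (bn : ℤ) (bd : ℕ) (ex : List (ℤ × ℕ)) : Bool :=
  ((List.range' 3 22).all fun pp =>
    (List.range' 2 (pp - 2)).all fun p =>
      !n1Admissible p pp || ratOutOrListed (n1CNum p pp) (2 * p * pp) an ad bn bd ex) &&
  ((List.range' 4 13).all fun pp =>
    (List.range' 3 (pp - 3)).all fun p =>
      !(Nat.gcd p pp == 1) || ratOutOrListed (w3CNum p pp) (p * pp) an ad bn bd ex) &&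
  ((List.range' 1 38).all fun k => ratOutOrListed ((3 * k : ℕ) : ℤ) (k + 2) an ad bn bd ex) &&
  ((List.range' 2 37).all fun k => ratOutOrListed ((2 * (k - 1) : ℕ) : ℤ) (k + 2) an ad bn bd ex)

/-- `cKacxExcluded a b ex = true` certifies: every member of `cKacxFamily` in `[a, b]` is listed in `ex`. -/
def cKacxExcluded (a b : ℚ) (ex : List ℚ) : Bool := cKacxCore a.num a.den b.num b.den (exZ ex)

/-- **Soundness of the KACX kind-`c` sentence.** -/
theorem cKacxExcluded_sound {a b : ℚ} {ex : List ℚ} (h : cKacxExcluded a b ex = true) {v : ℚ}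
    (hv : v ∈ cKacxFamily) (ha : a ≤ v) (hb : v ≤ b) : v ∈ ex := by
  unfold cKacxExcluded cKacxCore at h
  simp only [Bool.and_eq_true] at h
  obtain ⟨⟨⟨hN1, hW3⟩, hSU2⟩, hZK⟩ := h
  rcases hv with ((hv | hv) | hv) | hv
  · obtain ⟨p, pp, hp, hppp, hS, hadm, rfl⟩ := hv
    have h1 := List.all_eq_true.mp hN1 pp (List.mem_range'_1.mpr ⟨by omega, by omega⟩)
    have h2 := List.all_eq_true.mp h1 p (List.mem_range'_1.mpr ⟨hp, by omega⟩)
    rw [Bool.or_eq_true] at h2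
    rcases h2 with h2 | h2
    · simp [hadm] at h2
    · exact ratOutOrListed_sound (Nat.mul_pos (Nat.mul_pos (by norm_num) (by omega)) (by omega))
        h2 ha hb
  · obtain ⟨p, pp, hp, hppp, hS, hcop, rfl⟩ := hv
    have h1 := List.all_eq_true.mp hW3 pp (List.mem_range'_1.mpr ⟨by omega, by omega⟩)
    have h2 := List.all_eq_true.mp h1 p (List.mem_range'_1.mpr ⟨hp, by omega⟩)
    rw [Bool.or_eq_true] at h2
    rcases h2 with h2 | h2
    · simp [Nat.Coprime.gcd_eq_one hcop] at h2
    · exact ratOutOrListed_sound (Nat.mul_pos (by omega) (by omega)) h2 ha hb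
  · obtain ⟨k, hk, hkS, rfl⟩ := hv
    have h1 := List.all_eq_true.mp hSU2 k (List.mem_range'_1.mpr ⟨hk, by omega⟩)
    exact ratOutOrListed_sound (by positivity) h1 ha hb
  · obtain ⟨k, hk, hkS, rfl⟩ := hv
    have h1 := List.all_eq_true.mp hZK k (List.mem_range'_1.mpr ⟨hk, by omega⟩)
    exact ratOutOrListed_sound (by positivity) h1 ha hb

/-- Real-number form of the KACX kind-`c` sentence. -/
theorem ne_cKacx_of_cKacxExcluded {a b : ℚ} {ex : List ℚ} (h : cKacxExcluded a b ex = true)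
    {x : ℝ} (hx : (a : ℝ) ≤ x ∧ x ≤ b) (v : ℚ) (hv : v ∈ cKacxFamily) (hvex : v ∉ ex) :
    x ≠ (v : ℝ) := by
  rintro rfl
  exact hvex (cKacxExcluded_sound h hv (by exact_mod_cast hx.1) (by exact_mod_cast hx.2))

end Summit.CriticalPhenomena.Ising3D
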